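import Mathlib
import Summits.Ventures.PercRepro2.TablePackage
import Summits.Ventures.PercRepro2.UniversalBundleTower5

/-! # Packages certified by their tables, II: the avoidance hypotheses of the (L1) datum
(seat mine-b, cell pub-perc-repro2; MINE-B.md §25.12)

The two avoidance hypotheses of `universal_ser_bundle` on the (L1) datum — `g x` is not a slot-`0`
image of `f`, `g x` is not a red-up image — follow from list-level facts on the tables
(`tableG_avoids_slot0`, `tableG_avoids_theta`), and its injectivity from `inD1_inj_of_list`
with the list `d1List` (`tableG_inj`).  With TablePackage.lean this certifies a whole package
from its three tables. -/

namespace Summit.Ventures.PercRepro2.UHClosure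

open Finset

variable {X : Type*} [Preorder X] [Fintype X] [DecidableEq X]

section tables

variable (r b : X → ℕ)

omit [Preorder X] in
/-- **the (L1) datum avoids the slot-`0` images**, from the table: no value of `GT` on `d1List`
equals the target of a slot-`0` entry of `FT` -/
theorem tableG_avoids_slot0 (FT : List (X × ℕ × X)) (GT : List (X × X))
    (hcover : ∀ q : SlotL (USrc r b) b, ∃ e ∈ FT, e.1 = q.1.1.1 ∧ e.2.1 = q.1.2.val)
    (h : ∀ x ∈ d1List b FT, ∀ e ∈ FT, e.2.1 = 0 → e.2.2 ≠ tableMap GT x) :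
    ∀ x, InD1 r b (tableAssign r b FT) x →
      ∀ q : SlotL (USrc r b) b, q.1.2.val = 0 → tableAssign r b FT q ≠ tableMap GT x := by
  intro x hx q hq0
  obtain ⟨e, he, _, hk2, hv⟩ := tableAssign_find r b FT q (hcover q)
  rw [hv]
  exact h x (inD1_mem_d1List r b FT hcover x hx) e he (by rw [hk2, hq0])

omit [Preorder X] in
/-- **the (L1) datum avoids the red-up images**, from the tables: no value of `GT` on `d1List`
equals a value of `TT` -/
theorem tableG_avoids_theta (FT : List (X × ℕ × X)) (TT GT : List (X × X))
    (hcover : ∀ q : SlotL (USrc r b) b, ∃ e ∈ FT, e.1 = q.1.1.1 ∧ e.2.1 = q.1.2.val)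
    (hcoverQ : ∀ x, 1 ≤ r x → 2 ≤ b x → ∃ e ∈ TT, e.1 = x)
    (h : ∀ x ∈ d1List b FT, ∀ e ∈ TT, e.2 ≠ tableMap GT x) :
    ∀ x, InD1 r b (tableAssign r b FT) x →
      ∀ x', 1 ≤ r x' → 2 ≤ b x' → tableMap TT x' ≠ tableMap GT x := by
  intro x hx x' h1 h2
  obtain ⟨e, he, _, hv⟩ := tableMap_find TT x' (hcoverQ x' h1 h2)
  rw [hv]
  exact h x (inD1_mem_d1List r b FT hcover x hx) e he

/-- **the (L1) datum is injective**, from the table: `tableMap GT` is injective on `d1List` -/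
theorem tableG_inj (FT : List (X × ℕ × X)) (GT : List (X × X))
    (hcover : ∀ q : SlotL (USrc r b) b, ∃ e ∈ FT, e.1 = q.1.1.1 ∧ e.2.1 = q.1.2.val)
    (h : ∀ x ∈ d1List b FT, ∀ x' ∈ d1List b FT, tableMap GT x = tableMap GT x' → x = x') :
    ∀ x x', InD1 r b (tableAssign r b FT) x → InD1 r b (tableAssign r b FT) x' →
      tableMap GT x = tableMap GT x' → x = x' :=
  Summit.Ventures.PercRepro2.V2Closure.inD1_inj_of_list (d1List b FT) (inD1_mem_d1List r b FT hcover) h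

/-- **the (L1) datum lies below and is red-positive**, from the table -/
theorem tableG_spec (FT : List (X × ℕ × X)) (GT : List (X × X))
    (hcover : ∀ q : SlotL (USrc r b) b, ∃ e ∈ FT, e.1 = q.1.1.1 ∧ e.2.1 = q.1.2.val)
    (hcoverD : ∀ x ∈ d1List b FT, ∃ e ∈ GT, e.1 = x)
    (hvals : ∀ e ∈ GT, e.2 ≤ e.1 ∧ 1 ≤ r e.2) :
    ∀ x, InD1 r b (tableAssign r b FT) x → tableMap GT x ≤ x ∧ 1 ≤ r (tableMap GT x) := by
  intro x hx
  exact tableMap_spec GT (fun x => x ∈ d1List b FT) (fun x y => y ≤ x ∧ 1 ≤ r y)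
    hcoverD hvals x (inD1_mem_d1List r b FT hcover x hx)

end tables

end Summit.Ventures.PercRepro2.UHClosure
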